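import Summits.KontsevichZagierPeriods.KontsevichZagierPeriods.Theorems.EllipticMomentKernel.Negative.ModelCurve

/-!
# `EllipticMomentKernel` (stmt-KontsevichZagierPeriods-10631) — negative knowledge, part 6: roots and the oval for every admissible parameter

For every rational cubic `4x³ − q₂x − q₃` with `disc > 0`: `q₂ > 0`, the critical values
`f(−m) > 0 > f(m)` (`m = √(q₂/12)`), three located roots `e₃ < −m < e₂ < m < e₁` with
`f = 4(x − e₃)(x − e₂)(x − e₁)` (`exists_roots`, three IVTs), the sign pattern of the factored
cubic, `σ = (e₃, e₂)` (`oval_eq_of_roots`) and the quantifier-free description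
`σ = {f > 0} ∩ ({x < 0} ∪ {12x² < q₂})` (`oval_eq_setOf`). [folklore]
-/

noncomputable section

open MeasureTheory Set
open scoped BigOperators

namespace Summit.KontsevichZagierPeriods.HermiteRigidity.EllipticMomentKernelNegative

open Literature.NumberTheory.Transcendental
open Literature.NumberTheory.Transcendental.KZ
open Summit.KontsevichZagierPeriods.KontsevichZagierPeriods.Theses.HermiteRigidity (EllipticMomentKernel)

section GeneralCurve

open Literature.ModelTheory.ExponentialFields (IsSemialgebraic isSemialgebraic_setOf_eval_pos)
open MvPolynomial (aeval X C)


variable {q₂ q₃ : ℚ}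

/-- `disc > 0` forces `q₂ > 0`. [folklore] -/
theorem q₂_pos_of_disc_pos (h : 0 < disc q₂ q₃) : (0 : ℝ) < q₂ := by
  unfold disc at h
  by_contra hle
  push Not at hle
  have h3 : (q₂ : ℝ) ^ 3 ≤ 0 := by
    have : (q₂ : ℝ) ^ 3 = q₂ * q₂ ^ 2 := by ring
    rw [this]; exact mul_nonpos_of_nonpos_of_nonneg hle (sq_nonneg _)
  nlinarith [sq_nonneg (q₃ : ℝ)]

/-- Values at the critical points `∓m`, `m = √(q₂/12)`: `f(−m) > 0 > f(m)` when `disc > 0`.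
[folklore] -/
theorem cubic_crit (h : 0 < disc q₂ q₃) :
    0 < cubic q₂ q₃ (-Real.sqrt (q₂ / 12)) ∧ cubic q₂ q₃ (Real.sqrt (q₂ / 12)) < 0 := by
  have hq := q₂_pos_of_disc_pos h
  unfold disc at h
  set m := Real.sqrt (q₂ / 12) with hm
  have hm2 : m ^ 2 = q₂ / 12 := Real.sq_sqrt (by positivity)
  have hm0 : 0 < m := Real.sqrt_pos.2 (by positivity)
  have hfm : cubic q₂ q₃ (-m) = 2 / 3 * q₂ * m - q₃ := by
    unfold cubic; linear_combination (-4 * m) * hm2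
  have hfp : cubic q₂ q₃ m = -(2 / 3 * q₂ * m) - q₃ := by
    unfold cubic; linear_combination (4 * m) * hm2
  have hkey : (q₃ : ℝ) ^ 2 < (2 / 3 * q₂ * m) ^ 2 := by
    have : (2 / 3 * (q₂ : ℝ) * m) ^ 2 = (q₂ : ℝ) ^ 3 / 27 := by
      rw [mul_pow, hm2]; ring
    rw [this]; nlinarith
  have hpos : 0 < 2 / 3 * (q₂ : ℝ) * m := by positivity
  have hq3 := abs_lt.1 (abs_lt_of_sq_lt_sq hkey hpos.le)
  exact ⟨by rw [hfm]; linarith, by rw [hfp]; linarith⟩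

/-- Far to the left the cubic is negative, far to the right positive: at `∓K`,
`K = 1 + |q₂| + |q₃|`. [folklore] -/
theorem cubic_far :
    cubic q₂ q₃ (-(1 + |(q₂ : ℝ)| + |(q₃ : ℝ)|)) < 0 ∧ 0 < cubic q₂ q₃ (1 + |(q₂ : ℝ)| + |(q₃ : ℝ)|) := by
  set K : ℝ := 1 + |(q₂ : ℝ)| + |(q₃ : ℝ)| with hK
  have hK1 : 1 ≤ K := by have := abs_nonneg (q₂ : ℝ); have := abs_nonneg (q₃ : ℝ); linarith
  have hq2 : |(q₂ : ℝ)| ≤ K - 1 := by have := abs_nonneg (q₃ : ℝ); linarith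
  have hq3 : |(q₃ : ℝ)| ≤ K - 1 := by have := abs_nonneg (q₂ : ℝ); linarith
  have hb2 := abs_le.1 hq2
  have hb3 := abs_le.1 hq3
  have hK2 : K ^ 2 ≤ K ^ 3 := by nlinarith
  have hKK : 0 ≤ K := by linarith
  constructor
  · unfold cubic
    have : (q₂ : ℝ) * K ≤ (K - 1) * K := by nlinarith
    nlinarith
  · unfold cubic
    have : -(q₂ : ℝ) * K ≤ (K - 1) * K := by nlinarith
    nlinarith

/-- A cubic `4x³ − Ax − B` with three distinct roots `a, b, c` is `4(x − a)(x − b)(x − c)`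
(local copy of `PeriodPair.cubic_eq_prod_of_roots`). [folklore] -/
theorem cubic_eq_prod_of_roots {a b c : ℝ} (hab : a ≠ b) (hac : a ≠ c) (hbc : b ≠ c)
    (ha : cubic q₂ q₃ a = 0) (hb : cubic q₂ q₃ b = 0) (hc : cubic q₂ q₃ c = 0) (x : ℝ) :
    cubic q₂ q₃ x = 4 * (x - a) * (x - b) * (x - c) := by
  unfold cubic at *
  have h1 : 4 * (a ^ 2 + a * b + b ^ 2) - q₂ = 0 := by
    have : (a - b) * (4 * (a ^ 2 + a * b + b ^ 2) - q₂) = 0 := by linear_combination ha - hb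
    exact (mul_eq_zero.mp this).resolve_left (sub_ne_zero.mpr hab)
  have h2 : 4 * (a ^ 2 + a * c + c ^ 2) - q₂ = 0 := by
    have : (a - c) * (4 * (a ^ 2 + a * c + c ^ 2) - q₂) = 0 := by linear_combination ha - hc
    exact (mul_eq_zero.mp this).resolve_left (sub_ne_zero.mpr hac)
  have h3 : a + b + c = 0 := by
    have : (b - c) * (4 * (a + b + c)) = 0 := by linear_combination h1 - h2
    have := (mul_eq_zero.mp this).resolve_left (sub_ne_zero.mpr hbc)
    linarith
  have hc' : c = -a - b := by linarith
  subst hc'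
  have hq : (q₂ : ℝ) = 4 * (a ^ 2 + a * b + b ^ 2) := by linarith
  have hq' : (q₃ : ℝ) = 4 * a ^ 3 - 4 * (a ^ 2 + a * b + b ^ 2) * a := by linarith
  rw [hq, hq']; ring

/-- **Three real roots, located**: `e₃ < −m < e₂ < m < e₁` (`m = √(q₂/12)`) with
`f = 4(x − e₃)(x − e₂)(x − e₁)`, for every rational cubic with `disc > 0` (three intermediate
value theorems). [folklore] -/
theorem exists_roots (h : 0 < disc q₂ q₃) :
    ∃ e₃ e₂ e₁ : ℝ, e₃ < -Real.sqrt (q₂ / 12) ∧ -Real.sqrt (q₂ / 12) < e₂ ∧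
      e₂ < Real.sqrt (q₂ / 12) ∧ Real.sqrt (q₂ / 12) < e₁ ∧
      ∀ x, cubic q₂ q₃ x = 4 * (x - e₃) * (x - e₂) * (x - e₁) := by
  have hq := q₂_pos_of_disc_pos h
  obtain ⟨hcm, hcp⟩ := cubic_crit h
  obtain ⟨hfl, hfr⟩ := cubic_far (q₂ := q₂) (q₃ := q₃)
  set m := Real.sqrt (q₂ / 12) with hm
  set K : ℝ := 1 + |(q₂ : ℝ)| + |(q₃ : ℝ)| with hK
  have hm0 : 0 < m := Real.sqrt_pos.2 (by positivity)
  have hmK : m < K := by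
    have hK1 : 1 ≤ K := by have := abs_nonneg (q₂ : ℝ); have := abs_nonneg (q₃ : ℝ); linarith
    have hm2 : m ^ 2 = q₂ / 12 := Real.sq_sqrt (by positivity)
    have hq2 : (q₂ : ℝ) ≤ |(q₂ : ℝ)| := le_abs_self _
    have : m ^ 2 < K ^ 2 := by have := abs_nonneg (q₃ : ℝ); nlinarith
    exact lt_of_pow_lt_pow_left₀ 2 (by linarith) this
  have hcont : ∀ s : Set ℝ, ContinuousOn (cubic q₂ q₃) s := fun s =>
    (continuous_cubic (q₂ := q₂) (q₃ := q₃)).continuousOn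
  -- e₃ ∈ (−K, −m)
  obtain ⟨e₃, ⟨h3a, h3b⟩, he₃⟩ : ∃ e ∈ Icc (-K) (-m), cubic q₂ q₃ e = 0 :=
    intermediate_value_Icc (by linarith) (hcont _) ⟨hfl.le, hcm.le⟩
  -- e₂ ∈ (−m, m)
  obtain ⟨e₂, ⟨h2a, h2b⟩, he₂⟩ : ∃ e ∈ Icc (-m) m, cubic q₂ q₃ e = 0 :=
    intermediate_value_Icc' (by linarith) (hcont _) ⟨hcp.le, hcm.le⟩
  -- e₁ ∈ (m, K)
  obtain ⟨e₁, ⟨h1a, h1b⟩, he₁⟩ : ∃ e ∈ Icc m K, cubic q₂ q₃ e = 0 :=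
    intermediate_value_Icc hmK.le (hcont _) ⟨hcp.le, hfr.le⟩
  have h3b' : e₃ < -m := lt_of_le_of_ne h3b (by rintro rfl; exact hcm.ne' he₃)
  have h2a' : -m < e₂ := lt_of_le_of_ne h2a (by rintro h'; rw [← h'] at he₂; exact hcm.ne' he₂)
  have h2b' : e₂ < m := lt_of_le_of_ne h2b (by rintro rfl; exact hcp.ne he₂)
  have h1a' : m < e₁ := lt_of_le_of_ne h1a (by rintro h'; rw [← h'] at he₁; exact hcp.ne he₁)
  refine ⟨e₃, e₂, e₁, h3b', h2a', h2b', h1a', cubic_eq_prod_of_roots ?_ ?_ ?_ he₃ he₂ he₁⟩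
  · exact (h3b'.trans h2a').ne
  · exact (h3b'.trans (h2a'.trans (h2b'.trans h1a'))).ne
  · exact (h2b'.trans h1a').ne

/-- Sign of the factored cubic to the right of the largest root. [folklore] -/
theorem cubic_pos_of_gt {e₃ e₂ e₁ x : ℝ} (h32 : e₃ < e₂) (h21 : e₂ < e₁)
    (hf : ∀ x, cubic q₂ q₃ x = 4 * (x - e₃) * (x - e₂) * (x - e₁)) (hx : e₁ < x) :
    0 < cubic q₂ q₃ x := by
  rw [hf]
  have h1 : 0 < x - e₃ := by linarith
  have h2 : 0 < x - e₂ := by linarith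
  have h3 : 0 < x - e₁ := by linarith
  positivity

/-- Where the factored cubic is positive: `(e₃, e₂) ∪ (e₁, ∞)`. [folklore] -/
theorem mem_Ioo_or_gt_of_cubic_pos {e₃ e₂ e₁ x : ℝ} (h32 : e₃ < e₂) (h21 : e₂ < e₁)
    (hf : ∀ x, cubic q₂ q₃ x = 4 * (x - e₃) * (x - e₂) * (x - e₁)) (hx : 0 < cubic q₂ q₃ x) :
    x ∈ Ioo e₃ e₂ ∨ e₁ < x := by
  rw [hf] at hx
  by_cases h1 : e₁ < x
  · exact Or.inr h1
  push Not at h1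
  left
  rcases h1.lt_or_eq with h1 | h1
  · -- x < e₁: (x - e₁) < 0 so (x - e₃)(x - e₂) < 0
    have hprod : (x - e₃) * (x - e₂) < 0 := by
      by_contra hcon
      push Not at hcon
      have : 4 * (x - e₃) * (x - e₂) * (x - e₁) ≤ 0 := by
        rw [show 4 * (x - e₃) * (x - e₂) * (x - e₁) = (4 * ((x - e₃) * (x - e₂))) * (x - e₁) by ring]
        exact mul_nonpos_of_nonneg_of_nonpos (by positivity) (by linarith)
      linarith
    constructor
    · by_contra hxa
      push Not at hxa
      have : 0 ≤ (x - e₃) * (x - e₂) := mul_nonneg_of_nonpos_of_nonpos (by linarith) (by linarith)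
      linarith
    · by_contra hxb
      push Not at hxb
      have : 0 ≤ (x - e₃) * (x - e₂) := mul_nonneg (by linarith) (by linarith)
      linarith
  · subst h1; simp at hx

/-- The factored cubic is positive on `(e₃, e₂)` and negative on `(e₂, e₁)`. [folklore] -/
theorem cubic_sign_of_roots {e₃ e₂ e₁ : ℝ} (h32 : e₃ < e₂) (h21 : e₂ < e₁)
    (hf : ∀ x, cubic q₂ q₃ x = 4 * (x - e₃) * (x - e₂) * (x - e₁)) :
    (∀ x ∈ Ioo e₃ e₂, 0 < cubic q₂ q₃ x) ∧ ∀ x ∈ Ioo e₂ e₁, cubic q₂ q₃ x < 0 := by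
  constructor
  · intro x hx
    rw [hf, show 4 * (x - e₃) * (x - e₂) * (x - e₁) = 4 * (x - e₃) * (e₂ - x) * (e₁ - x) by ring]
    have h1 : 0 < x - e₃ := by linarith [hx.1]
    have h2 : 0 < e₂ - x := by linarith [hx.2]
    have h3 : 0 < e₁ - x := by linarith [hx.2]
    positivity
  · intro x hx
    rw [hf]
    have h1 : 0 < x - e₃ := by linarith [hx.1]
    have h2 : 0 < x - e₂ := by linarith [hx.1]
    have h3 : 0 < e₁ - x := by linarith [hx.2]
    have : 0 < 4 * (x - e₃) * (x - e₂) * (e₁ - x) := by positivity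
    linarith

/-- **`σ = (e₃, e₂)`** for the located roots. [folklore] -/
theorem oval_eq_of_roots {e₃ e₂ e₁ : ℝ} (h32 : e₃ < e₂) (h21 : e₂ < e₁)
    (hf : ∀ x, cubic q₂ q₃ x = 4 * (x - e₃) * (x - e₂) * (x - e₁)) :
    oval q₂ q₃ = {p | p 0 ∈ Ioo e₃ e₂} := by
  obtain ⟨hpos, hneg⟩ := cubic_sign_of_roots h32 h21 hf
  ext p
  simp only [oval, mem_setOf_eq]
  constructor
  · rintro ⟨hp, t, hpt, hft⟩
    rcases mem_Ioo_or_gt_of_cubic_pos h32 h21 hf hp with h | h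
    · exact h
    · exact absurd hft (not_lt.2 (cubic_pos_of_gt h32 h21 hf (h.trans hpt)).le)
  · intro hp
    refine ⟨hpos _ hp, (e₂ + e₁) / 2, by linarith [hp.2], hneg _ ⟨by linarith, by linarith⟩⟩

/-- **`σ` quantifier-free**: `σ = {f > 0} ∩ ({x < 0} ∪ {12x² < q₂})` when `disc > 0` (the right
critical point `m = √(q₂/12)` separates `(e₃, e₂)` from `(e₁, ∞)`). [folklore] -/
theorem oval_eq_setOf (h : 0 < disc q₂ q₃) :
    oval q₂ q₃ = {p | 0 < cubic q₂ q₃ (p 0) ∧ (p 0 < 0 ∨ 12 * p 0 ^ 2 < (q₂ : ℝ))} := by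
  obtain ⟨e₃, e₂, e₁, h3, h2a, h2b, h1, hf⟩ := exists_roots h
  have hq := q₂_pos_of_disc_pos h
  set m := Real.sqrt (q₂ / 12) with hm
  have hm2 : m ^ 2 = q₂ / 12 := Real.sq_sqrt (by positivity)
  have hm0 : 0 < m := Real.sqrt_pos.2 (by positivity)
  have h32 : e₃ < e₂ := by linarith
  have h21 : e₂ < e₁ := by linarith
  rw [oval_eq_of_roots h32 h21 hf]
  obtain ⟨hpos, -⟩ := cubic_sign_of_roots h32 h21 hf
  ext p
  simp only [mem_setOf_eq, mem_Ioo]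
  constructor
  · intro hp
    refine ⟨hpos _ hp, ?_⟩
    by_cases hx : p 0 < 0
    · exact Or.inl hx
    · push Not at hx
      right
      have : p 0 < m := by linarith [hp.2]
      nlinarith
  · rintro ⟨hp, hx⟩
    rcases mem_Ioo_or_gt_of_cubic_pos h32 h21 hf hp with h' | h'
    · exact h'
    · exfalso
      have hxm : m < p 0 := by linarith
      rcases hx with hx | hx
      · linarith
      · nlinarith

end GeneralCurve

end Summit.KontsevichZagierPeriods.HermiteRigidity.EllipticMomentKernelNegative
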